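import Summits.QuantumFields.YangMills.Theorems.ColdStartUniversalityShenZhuZhuLimitVarianceSUN
import Summits.QuantumFields.YangMills.Theorems.ColdStartUniversalityLatticeLangevinGradientFormTorus
import Literature.MathematicalPhysics.QuantumFieldTheory.SUNBakryEmeryFrameConjugation
import HarnessLib

/-!
# Shen–Zhu–Zhu's Poincaré inequality IN THE PRINTED GRADIENT FORM for EVERY `SU(N)` and EVERY dimension `d`:
# `Var_μ(F) ≤ (1/K) Σ_e μ(|∇_e F|²)` on every torus (Cor. 4.4 (4.11)) and for every infinite-volume limit point (Thm 1.4 (1.10) / Cor. 4.5 (4.13)),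
# `K = N/2 − N|β|Λ₀` for any torus Hessian constant `Λ₀` — sharp `K = N/2 − 4dN|β|`, printed `K_S = N/2 − 8(d−1)N|β|`

Seat `ym-line-csu-p1` (g40), route `ColdStartUniversality` of `Summits/QuantumFields/YangMills`, helper file G31 (strong coupling; `--supports
stmt-QuantumFields-24809`).  G21/G24 (g39) proved the Poincaré inequality for every `SU(N)`, `d` in LIPSCHITZ form (`Σ_e ℓ_e²`) from the venture `YMGap`'s
built multi-link Bakry–Émery inequality `poincare_gibbs`; g38 proved the PRINTED gradient form (`Σ_e μ(|∇_e F|²)`, the Literature's `linkGradSq`) only for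
`SU(2)`, `d = 3`.  Here the printed gradient form for ALL `N ≥ 1`, `d`:
* §1 ★★ `torus_variance_le_integral_Gam_sun` — `Var_{μ_{Λ_L,Nβ}}(u) ≤ (∫ Γ(u,u) dμ_{Λ_L,Nβ})/K` for every smooth `u` of the link matrices (adapted from the
  venture leaf `Thresholds/SharpPoincare.lean`, `torus_variance_le_integral_Gam`, NOT built on the farm; its imports are).
* §2 ★ `Gam_cylinder_eq_sum_linkGradSq` — dictionary: for a cylinder `F = f((U_e)_{e∈Λ})` pulled back to a torus onto which `Λ` projects injectively, the
  venture's carré du champ `Γ` (LEFT-invariant frame derivatives) IS `Σ_{e∈Λ} linkGradSq Λ f e` (RIGHT-invariant `|∇_e F|²`), by the Literature's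
  `sum_sq_apply_frame_mul_eq_sum_sq_apply_mul_frame`.
* §3 ★★ `torus_cylinder_variance_gradient_sun` — SZZ Cor. 4.4 (4.11), Poincaré half, verbatim, every `SU(N)`, `d`, torus, `Λ₀`.
* §4 ★★★ `szz_cylinder_variance_gradient_limit_sun` — SZZ Thm 1.4 (1.10) / Cor. 4.5 (4.13), Poincaré half, gradient form, EVERY infinite-volume limit point,
  every `SU(N)`, `d`, `Λ₀`; instances ★★★ `szz_poincare_gradient_sharp_sun` (`Λ₀ = 4d`, venture kernel theorem `wilsonHessianBound_four_d`) and
  ★★★ `szz_poincare_gradient_printed_sun` — THE PRINTED STATEMENT (`d ≥ 2`, `|β| < 1/(16(d−1))`, `K_S = szzBakryEmeryConstSU N d β`); torus twin.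

THEOREMS ONLY, no definition, no sorry.  The log-Sobolev half (1.9)/(4.12) in gradient form for general `(d, N)` is NOT here (needs the Langevin semigroup
for general `d, N`; the tree has `SU(2)`, `d = 3`, g38).  HONEST FRAMING: STRONG coupling, lattice; nothing at weak coupling / in the continuum, nothing
`K`-uniform along the route's scaling (`UniformColdStartMixing`, 24809, ASIDE, not restated); no crux, rung or summit statement is proved; the Yang–Mills
mass gap is NOT proved.  References: H. Shen, R. Zhu, X. Zhu, CMP 400 (2023) 805–851 = arXiv:2204.12737, Thm 1.4 (1.10), Cor. 4.4 (4.11), Cor. 4.5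
(4.13), §2 (2.3)–(2.4) [ShenZhuZhu2022]; Bakry–Émery, LNM 1123 (1985); Bakry–Gentil–Ledoux, Grundlehren 348, Prop. 4.8.1.
-/

set_option autoImplicit false

noncomputable section

namespace Summit.QuantumFields.YangMills.Theorems.ColdStartUniversality

open MeasureTheory ProbabilityTheory Finset Filter Set Function
open scoped BigOperators NNReal ENNReal Topology Matrix Matrix.Norms.Frobenius ContDiff
open Literature.MathematicalPhysics.QuantumFieldTheory
open Literature.MathematicalPhysics.QuantumLattice (fundamentalRep continuous_fundamentalRep fundamentalRep_apply torusEdge torusLift LGConfig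
  toTorusObservable infiniteVolumeLimitPoints IsCylinder)
open Literature.MathematicalPhysics.QuantumFieldTheory.SUNBakryEmery (SUN FrameIdx frame)
open Summit.Ventures.YMGap.LatticeBakryEmery (PSU Cfg emb emb_apply haarPi Gam lk algD algD_apply linkFun linkFun_apply
  Gam_self_eq_sum_linkFun wilsonPot wilsonPot_mem_polySpace hessBound_wilsonPot contDiff_wilsonPot exp_neg_mul_wilsonAction_eq poincare_gibbs
  integrable_of_continuous_PSU continuous_restrict contDiff_Gam)
open Summit.Ventures.YMGap.HessianSharp (wilsonHessianBound_four_d)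

variable {d N : ℕ}

/-! ## §1. The torus Poincaré inequality in Γ-form for every `SU(N)` and every `d` -/

section Torus

variable {L : ℕ} [NeZero L]

/-- ★★ **Torus Poincaré inequality, Γ (Dirichlet-form) form, every `SU(N)`, every `d`, every torus Hessian constant `Λ₀`** (Shen–Zhu–Zhu Cor. 4.4
(4.11) with `K_S` replaced by `K = N/2 − N|β|Λ₀`): for every smooth function `u` of the link matrices,
`Var_{μ_{Λ_L,Nβ}}(u) ≤ (∫ Γ(u,u) dμ_{Λ_L,Nβ})/K`, `Γ` the carré du champ of the product Hilbert–Schmidt metric (venture `Gam`).  Kernel theorem from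
the venture `YMGap`'s BUILT `poincare_gibbs`; adapted from its unbuilt leaf `Thresholds/SharpPoincare.lean` (`torus_variance_le_integral_Gam`).
The Yang–Mills mass gap is NOT proved. [cite: ShenZhuZhu2022, Corollary 4.4 (4.11)] -/
theorem torus_variance_le_integral_Gam_sun {Λ₀ : ℝ} (hH : WilsonHessianBound d N Λ₀) (hN : N ≠ 0) (β : ℝ)
    (hK : 0 < (N : ℝ) / 2 - N * |β| * Λ₀) {u : Cfg (Edge d L) N → ℝ} (hu : ContDiff ℝ ∞ u) :
    Var[fun U : GaugeConfig d L (SUN N) => u (emb U); wilsonMeasure (d := d) (L := L) (fundamentalRep (Fin N)) ((N : ℝ) * β)] ≤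
      (∫ U, Gam u u (emb U) ∂(wilsonMeasure (d := d) (L := L) (fundamentalRep (Fin N)) ((N : ℝ) * β))) / ((N : ℝ) / 2 - N * |β| * Λ₀) := by
  -- adapted from Summits/Ventures/YMGap/Thresholds/SharpPoincare.lean (`integral_wilsonMeasure_eq_div`, `torus_variance_le_integral_Gam`)
  set μ := wilsonMeasure (d := d) (L := L) (fundamentalRep (Fin N)) ((N : ℝ) * β) with hμ
  set S := wilsonPot d N L β with hS
  set Z : ℝ := ∫ U, Real.exp (S (emb U)) ∂(haarPi (Edge d L) N) with hZ
  -- torus expectations as `e^S`-weighted product-Haar averages (the constant `e^{-N²β|P|}` cancels)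
  have hrep : ∀ φ : PSU (Edge d L) N → ℝ,
      ∫ U, φ U ∂μ = (∫ U, Real.exp (S (emb U)) * φ U ∂(haarPi (Edge d L) N)) / Z := by
    intro φ
    have h := wilsonExpectation_eq_integral_div (d := d) (L := L) (fundamentalRep (Fin N))
      (continuous_fundamentalRep (n := Fin N)) ((N : ℝ) * β) φ
    unfold wilsonExpectation at h
    rw [hμ, h]
    set C : ℝ := Real.exp (-((N : ℝ) * β * N * Fintype.card (Plaquette d L))) with hC
    have hCpos : 0 < C := Real.exp_pos _
    have e1 : (fun U : GaugeConfig d L (SUN N) => φ U * Real.exp (-((N : ℝ) * β) * wilsonAction (fundamentalRep (Fin N)) U))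
        = fun U => C * (Real.exp (S (emb U)) * φ U) := by
      funext U; rw [exp_neg_mul_wilsonAction_eq]; ring
    have e2 : (fun U : GaugeConfig d L (SUN N) => Real.exp (-((N : ℝ) * β) * wilsonAction (fundamentalRep (Fin N)) U))
        = fun U => C * Real.exp (S (emb U)) := by
      funext U; rw [exp_neg_mul_wilsonAction_eq]
    show (∫ U, φ U * Real.exp (-((N : ℝ) * β) * wilsonAction (fundamentalRep (Fin N)) U) ∂(haarPi (Edge d L) N)) /
        (∫ U, Real.exp (-((N : ℝ) * β) * wilsonAction (fundamentalRep (Fin N)) U) ∂(haarPi (Edge d L) N)) = _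
    rw [e1, e2, integral_const_mul, integral_const_mul, mul_div_mul_left _ _ hCpos.ne']
  have hSc : Continuous fun U : PSU (Edge d L) N => S (emb U) := continuous_restrict (contDiff_wilsonPot β)
  have hZpos : 0 < Z := integral_exp_pos (integrable_of_continuous_PSU (Real.continuous_exp.comp hSc) _)
  have hφc : Continuous fun U : PSU (Edge d L) N => u (emb U) := continuous_restrict hu
  set m : ℝ := (∫ U, Real.exp (S (emb U)) * u (emb U) ∂(haarPi (Edge d L) N)) / Z with hm
  have hmean : ∫ U, u (emb U) ∂μ = m := hrep _
  have hvar : Var[fun U => u (emb U); μ] =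
      (∫ U, Real.exp (S (emb U)) * (u (emb U) - m) ^ 2 ∂(haarPi (Edge d L) N)) / Z := by
    rw [variance_eq_integral hφc.measurable.aemeasurable]
    simp only [hmean]
    exact hrep _
  have hG : ∫ U, Gam u u (emb U) ∂μ = (∫ U, Real.exp (S (emb U)) * Gam u u (emb U) ∂(haarPi (Edge d L) N)) / Z := hrep _
  have hP := poincare_gibbs (ι := Edge d L) hN (wilsonPot_mem_polySpace β) (hessBound_wilsonPot hH β) hK hu
  rw [hvar, hG, div_div, div_le_div_iff₀ hZpos (mul_pos hZpos hK)]
  calc (∫ U, Real.exp (S (emb U)) * (u (emb U) - m) ^ 2 ∂(haarPi (Edge d L) N)) * (Z * ((N : ℝ) / 2 - N * |β| * Λ₀))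
      = (((N : ℝ) / 2 - N * |β| * Λ₀) * ∫ U, Real.exp (S (emb U)) * (u (emb U) - m) ^ 2 ∂(haarPi (Edge d L) N)) * Z := by ring
    _ ≤ (∫ U, Real.exp (S (emb U)) * Gam u u (emb U) ∂(haarPi (Edge d L) N)) * Z := mul_le_mul_of_nonneg_right hP hZpos.le

end Torus

/-! ## §2. The dictionary: `Γ` of a pulled-back cylinder function = `Σ_e linkGradSq` -/

section Dictionary

variable {L : ℕ} [NeZero L]

/-- ★ **The venture's carré du champ of a cylinder function IS the Literature's sum of squared link gradients**: for a torus `(ℤ/L)^d` onto which the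
finite edge set `Λ ⊆ E⁺(ℤ^d)` projects injectively, a smooth `f` of the link matrices over `Λ` and `u(Q) = f((Q_{π e})_{e∈Λ})`, at every `SU(N)`-valued
configuration `U`: `Γ(u,u)(U) = Σ_{e∈Λ} linkGradSq Λ f e ((U_{π e})_{e∈Λ})` — left-invariant frame derivatives (`Gam`) versus right-invariant ones
(`linkGradSq`), equal by the bi-invariance of the Hilbert–Schmidt metric (`sum_sq_apply_frame_mul_eq_sum_sq_apply_mul_frame`); links off `π(Λ)` do not
contribute. [cite: ShenZhuZhu2022, §2 (2.3)–(2.4)] -/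
theorem Gam_cylinder_eq_sum_linkGradSq (hN : N ≠ 0) (Λ : Finset (Literature.MathematicalPhysics.QuantumLattice.ZdEdge d))
    (hinj : Set.InjOn (torusEdge (d := d) L) ↑Λ) {f : (↥Λ → Matrix (Fin N) (Fin N) ℂ) → ℝ} (hf : ContDiff ℝ ∞ f)
    (U : GaugeConfig d L (SUN N)) :
    Gam (fun Q : Cfg (Edge d L) N => f fun e : ↥Λ => Q (torusEdge L e.1))
        (fun Q : Cfg (Edge d L) N => f fun e : ↥Λ => Q (torusEdge L e.1)) (emb U) =
      ∑ e : ↥Λ, linkGradSq Λ f e (fun e' : ↥Λ => ((U (torusEdge L e'.1) : SUN N) : Matrix (Fin N) (Fin N) ℂ)) := by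
  classical
  -- the (continuous linear) projection `P Q = (Q_{π e})_{e∈Λ}` and the pulled-back function `u = f ∘ P`
  set P : Cfg (Edge d L) N →L[ℝ] (↥Λ → Matrix (Fin N) (Fin N) ℂ) :=
    ContinuousLinearMap.pi fun e : ↥Λ =>
      ContinuousLinearMap.proj (R := ℝ) (φ := fun _ : Edge d L => Matrix (Fin N) (Fin N) ℂ) (torusEdge L e.1) with hP
  have hPapp : ∀ Q : Cfg (Edge d L) N, P Q = fun e : ↥Λ => Q (torusEdge L e.1) := fun Q => rfl
  set u : Cfg (Edge d L) N → ℝ := fun Q => f fun e : ↥Λ => Q (torusEdge L e.1) with hudef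
  have hu : u = f ∘ P := rfl
  set M : ↥Λ → Matrix (Fin N) (Fin N) ℂ := fun e' => ((U (torusEdge L e'.1) : SUN N) : Matrix (Fin N) (Fin N) ℂ) with hM
  have hMP : P (emb U) = M := rfl
  have hfd : Differentiable ℝ f := hf.differentiable (by simp)
  -- chain rule
  have hFD : HasFDerivAt u ((fderiv ℝ f M).comp P) (emb U) := by
    rw [hu, ← hMP]
    exact (hfd (P (emb U))).hasFDerivAt.comp (emb U) P.hasFDerivAt
  have halgD : ∀ (e' : Edge d L) (Y : Matrix (Fin N) (Fin N) ℂ), algD (lk e' Y) u (emb U) = fderiv ℝ f M (P (emb U * lk e' Y)) := by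
    intro e' Y
    rw [algD_apply]
    exact congrFun (congrArg DFunLike.coe hFD.fderiv) (emb U * lk e' Y)
  -- the projected directions
  have hPlk_mem : ∀ (e : ↥Λ) (Y : Matrix (Fin N) (Fin N) ℂ), P (emb U * lk (torusEdge L e.1) Y) = Pi.single e (M e * Y) := by
    intro e Y
    rw [hPapp]; funext e₂
    by_cases h : e₂ = e
    · subst h
      simp [lk, hM]
    · have hne : torusEdge L e₂.1 ≠ torusEdge L e.1 := fun heq => h (Subtype.ext (hinj e₂.2 e.2 heq))
      simp [lk, Pi.single_eq_of_ne hne, Pi.single_eq_of_ne h]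
  have hPlk_not : ∀ e' : Edge d L, (∀ e : ↥Λ, torusEdge L e.1 ≠ e') → ∀ Y : Matrix (Fin N) (Fin N) ℂ, P (emb U * lk e' Y) = 0 := by
    intro e' he' Y
    rw [hPapp]; funext e₂; simp [lk, Pi.single_eq_of_ne (he' e₂)]
  -- link by link
  have hterm : ∀ e' : Edge d L, ∑ α : FrameIdx N, linkFun u (emb U) e' (frame α) ^ 2 =
      ∑ e : ↥Λ, if torusEdge L e.1 = e' then linkGradSq Λ f e M else 0 := by
    intro e'
    by_cases hex : ∃ e : ↥Λ, torusEdge L e.1 = e'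
    · obtain ⟨e, rfl⟩ := hex
      rw [Finset.sum_eq_single e (fun e₂ _ hne => if_neg fun heq => hne (Subtype.ext (hinj e₂.2 e.2 heq)))
        (fun h => absurd (Finset.mem_univ e) h), if_pos rfl, linkGradSq_eq_sum_sq_fderiv Λ hfd e M]
      simp only [linkFun_apply, halgD, hPlk_mem]
      -- left versus right frame derivatives
      set lam : Matrix (Fin N) (Fin N) ℂ →ₗ[ℝ] ℝ :=
        (fderiv ℝ f M).toLinearMap.comp (LinearMap.single ℝ (fun _ : ↥Λ => Matrix (Fin N) (Fin N) ℂ) e) with hlam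
      have hlam_apply : ∀ A, lam A = fderiv ℝ f M (Pi.single e A) := fun A => rfl
      have hUe : M e ∈ Matrix.unitaryGroup (Fin N) ℂ := (U (torusEdge L e.1)).2.1
      have hQ1 : M e * (M e)ᴴ = 1 := Matrix.mem_unitaryGroup_iff.1 hUe
      have hQ2 : (M e)ᴴ * M e = 1 := Matrix.mem_unitaryGroup_iff'.1 hUe
      have h := SUNBakryEmery.sum_sq_apply_frame_mul_eq_sum_sq_apply_mul_frame hN lam hQ1 hQ2
      simp only [hlam_apply] at h
      exact h.symm
    · push Not at hex
      rw [Finset.sum_eq_zero fun e _ => if_neg (hex e)]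
      refine Finset.sum_eq_zero fun α _ => ?_
      rw [linkFun_apply, halgD, hPlk_not e' hex, map_zero, sq, mul_zero]
  rw [Gam_self_eq_sum_linkFun]
  simp_rw [hterm]
  rw [Finset.sum_comm]
  refine Finset.sum_congr rfl fun e _ => ?_
  rw [Finset.sum_ite_eq]
  simp

end Dictionary

/-! ## §3. Shen–Zhu–Zhu's (4.11) on every torus, gradient form, every `SU(N)`, `d` -/

section TorusCylinder

variable {L : ℕ} [NeZero L]

omit [NeZero L] in
/-- The squared link gradient of a smooth cylinder function, pulled back to the torus, is continuous. [cite: ShenZhuZhu2022, (1.8)] -/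
theorem continuous_linkGradSq_torusLift (Λ : Finset (Literature.MathematicalPhysics.QuantumLattice.ZdEdge d))
    {f : (↥Λ → Matrix (Fin N) (Fin N) ℂ) → ℝ} (hf : ContDiff ℝ ∞ f) (e : ↥Λ) :
    Continuous fun V : GaugeConfig d L (SUN N) =>
      linkGradSq Λ f e (fun e' : ↥Λ => ((torusLift L V e'.1 : SUN N) : Matrix (Fin N) (Fin N) ℂ)) :=
  (continuous_linkGradSq Λ hf e).comp (continuous_pi fun _ => continuous_subtype_val.comp (continuous_apply _))

/-- ★★ **SZZ Corollary 4.4 (4.11), Poincaré half, VERBATIM gradient form, every `SU(N)`, every `d`, every torus, every torus Hessian constant `Λ₀`**: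
for `K = N/2 − N|β|Λ₀ > 0`, every finite `Λ ⊆ E⁺(ℤ^d)` projecting injectively onto `(ℤ/L)^d` and every smooth `f` of the link matrices over `Λ`,
`Var_{μ_{Λ_L,Nβ}}(F∘lift) ≤ (Σ_{e∈Λ} ∫ |∇_e F|² dμ_{Λ_L,Nβ})/K`, `F = f((U_e)_{e∈Λ})`, `|∇_e F|² = linkGradSq Λ f e`.  The Yang–Mills mass gap is NOT proved.
[cite: ShenZhuZhu2022, Corollary 4.4 (4.11)] -/
theorem torus_cylinder_variance_gradient_sun {Λ₀ : ℝ} (hH : WilsonHessianBound d N Λ₀) (hN : N ≠ 0) {β : ℝ}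
    (hK : 0 < (N : ℝ) / 2 - N * |β| * Λ₀) (Λ : Finset (Literature.MathematicalPhysics.QuantumLattice.ZdEdge d))
    (hinj : Set.InjOn (torusEdge (d := d) L) ↑Λ) (f : (↥Λ → Matrix (Fin N) (Fin N) ℂ) → ℝ) (hf : ContDiff ℝ ∞ f) :
    Var[fun V : GaugeConfig d L (SUN N) => matrixCylinder Λ f (torusLift L V); wilsonMeasure (d := d) (L := L) (fundamentalRep (Fin N)) ((N : ℝ) * β)] ≤
      (∑ e : ↥Λ, ∫ V, linkGradSq Λ f e (fun e' : ↥Λ => ((torusLift L V e'.1 : SUN N) : Matrix (Fin N) (Fin N) ℂ))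
          ∂(wilsonMeasure (d := d) (L := L) (fundamentalRep (Fin N)) ((N : ℝ) * β))) / ((N : ℝ) / 2 - N * |β| * Λ₀) := by
  classical
  set μ := wilsonMeasure (d := d) (L := L) (fundamentalRep (Fin N)) ((N : ℝ) * β) with hμ
  haveI : IsProbabilityMeasure μ :=
    isProbabilityMeasure_wilsonMeasure (d := d) (L := L) (fundamentalRep (Fin N)) (continuous_fundamentalRep (n := Fin N)) ((N : ℝ) * β)
  have hu : ContDiff ℝ ∞ fun Q : Cfg (Edge d L) N => f fun e' : ↥Λ => Q (torusEdge L e'.1) :=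
    hf.comp (contDiff_pi.2 fun e' => contDiff_apply ℝ (Matrix (Fin N) (Fin N) ℂ) (torusEdge L e'.1))
  have h := torus_variance_le_integral_Gam_sun (L := L) hH hN β hK hu
  have hfun : (fun U : GaugeConfig d L (SUN N) => f fun e' : ↥Λ => emb U (torusEdge L e'.1)) =
      fun V => matrixCylinder Λ f (torusLift L V) := by
    funext V; rfl
  have hGam : (fun U : GaugeConfig d L (SUN N) => Gam (fun Q : Cfg (Edge d L) N => f fun e : ↥Λ => Q (torusEdge L e.1))
      (fun Q : Cfg (Edge d L) N => f fun e : ↥Λ => Q (torusEdge L e.1)) (emb U)) =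
      fun V => ∑ e : ↥Λ, linkGradSq Λ f e (fun e' : ↥Λ => ((torusLift L V e'.1 : SUN N) : Matrix (Fin N) (Fin N) ℂ)) := by
    funext V
    rw [Gam_cylinder_eq_sum_linkGradSq hN Λ hinj hf V]
    rfl
  rw [hfun, hGam, integral_finsetSum _ fun e _ =>
    (continuous_linkGradSq_torusLift (L := L) Λ hf e).integrable_of_hasCompactSupport (HasCompactSupport.of_compactSpace _)] at h
  exact h

/-- ★★★ **SZZ Corollary 4.4 (4.11), Poincaré half, gradient form, SHARP window, every `SU(N)`, every `d`, every torus**: with the venture's kernel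
Hessian constant `Λ₀ = 4d`, `K = N/2 − 4dN|β|` (`|β| < 1/(8d)`): `Var_{μ_{Λ_L,Nβ}}(F∘lift) ≤ (Σ_{e∈Λ} ∫ |∇_e F|² dμ_{Λ_L,Nβ})/K`.  The Yang–Mills mass gap
is NOT proved. [cite: ShenZhuZhu2022, Corollary 4.4 (4.11)] -/
theorem torus_cylinder_variance_gradient_sharp_sun (hN : N ≠ 0) {β : ℝ} (hK : 0 < (N : ℝ) / 2 - N * |β| * (4 * d))
    (Λ : Finset (Literature.MathematicalPhysics.QuantumLattice.ZdEdge d)) (hinj : Set.InjOn (torusEdge (d := d) L) ↑Λ)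
    (f : (↥Λ → Matrix (Fin N) (Fin N) ℂ) → ℝ) (hf : ContDiff ℝ ∞ f) :
    Var[fun V : GaugeConfig d L (SUN N) => matrixCylinder Λ f (torusLift L V); wilsonMeasure (d := d) (L := L) (fundamentalRep (Fin N)) ((N : ℝ) * β)] ≤
      (∑ e : ↥Λ, ∫ V, linkGradSq Λ f e (fun e' : ↥Λ => ((torusLift L V e'.1 : SUN N) : Matrix (Fin N) (Fin N) ℂ))
          ∂(wilsonMeasure (d := d) (L := L) (fundamentalRep (Fin N)) ((N : ℝ) * β))) / ((N : ℝ) / 2 - N * |β| * (4 * d)) :=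
  torus_cylinder_variance_gradient_sun (wilsonHessianBound_four_d d N) hN hK Λ hinj f hf

end TorusCylinder

/-! ## §4. Shen–Zhu–Zhu's (1.10)/(4.13) for every infinite-volume limit point, gradient form, every `SU(N)`, `d` -/

section Limits

/-- The squared link gradients are nonnegative. [cite: ShenZhuZhu2022, (1.8)] -/
theorem linkGradSq_nonneg' (Λ : Finset (Literature.MathematicalPhysics.QuantumLattice.ZdEdge d))
    (f : (↥Λ → Matrix (Fin N) (Fin N) ℂ) → ℝ) (e : ↥Λ) (M : ↥Λ → Matrix (Fin N) (Fin N) ℂ) : 0 ≤ linkGradSq Λ f e M := by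
  unfold linkGradSq
  exact Finset.sum_nonneg fun α _ => sq_nonneg _

/-- ★★★ **Shen–Zhu–Zhu's Theorem 1.4 (1.10) / Corollary 4.5 (4.13) — the Poincaré inequality in the PRINTED GRADIENT FORM for every infinite-volume limit
point, every `SU(N)`, every `d`, every torus Hessian constant `Λ₀`**: for `K = N/2 − N|β|Λ₀ > 0`, every tight limit `μ` of the torus `SU(N)` Wilson states
at tree coupling `Nβ`, every finite `Λ ⊆ E⁺(ℤ^d)` and every smooth `f`: `Var_μ(F) ≤ (Σ_{e∈Λ} ∫ |∇_e F|² dμ)/K`, `F = f((U_e)_{e∈Λ})`,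
`|∇_e F|² = linkGradSq Λ f e`.  Limit passage along tori (cylinder observables on large tori inject).  The Yang–Mills mass gap is NOT proved.
[cite: ShenZhuZhu2022, Theorem 1.4 (1.10), Corollary 4.5 (4.13)] -/
theorem szz_cylinder_variance_gradient_limit_sun {Λ₀ : ℝ} (hH : WilsonHessianBound d N Λ₀) (hN : N ≠ 0) {β : ℝ}
    (hK : 0 < (N : ℝ) / 2 - N * |β| * Λ₀)
    {μ : Measure (LGConfig d (SUN N))} (hμ : μ ∈ infiniteVolumeLimitPoints (d := d) (fundamentalRep (Fin N)) ((N : ℝ) * β))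
    (Λ : Finset (Literature.MathematicalPhysics.QuantumLattice.ZdEdge d)) (f : (↥Λ → Matrix (Fin N) (Fin N) ℂ) → ℝ) (hf : ContDiff ℝ ∞ f) :
    Var[matrixCylinder Λ f; μ] ≤
      (∑ e : ↥Λ, ∫ U, linkGradSq Λ f e (fun e' : ↥Λ => ((U e'.1 : SUN N) : Matrix (Fin N) (Fin N) ℂ)) ∂μ) / ((N : ℝ) / 2 - N * |β| * Λ₀) := by
  -- limit passage as in G24 / g38's `szzGradientForm_su2_of_hessBound`
  obtain ⟨Ls, hLs, hprob, hlim⟩ := hμ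
  haveI := hprob
  set β' : ℝ := (N : ℝ) * β with hβ'
  set K : ℝ := (N : ℝ) / 2 - N * |β| * Λ₀ with hKdef
  set F : LGConfig d (SUN N) → ℝ := matrixCylinder Λ f with hF
  set Gr : ↥Λ → LGConfig d (SUN N) → ℝ :=
    fun e U => linkGradSq Λ f e (fun e' : ↥Λ => ((U e'.1 : SUN N) : Matrix (Fin N) (Fin N) ℂ)) with hGr
  set S : ℝ := ∑ e : ↥Λ, ∫ U, Gr e U ∂μ with hSdef
  -- bounded continuous cylinder functions
  have hbdd : ∀ {G : LGConfig d (SUN N) → ℝ}, Continuous G → ∃ C, ∀ U, |G U| ≤ C := by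
    intro G hG
    obtain ⟨C, hC⟩ := (isCompact_univ (X := LGConfig d (SUN N))).exists_bound_of_continuousOn hG.continuousOn
    exact ⟨C, fun U => by simpa [Real.norm_eq_abs] using hC U (Set.mem_univ _)⟩
  have hres : Continuous fun U : LGConfig d (SUN N) => (fun e' : ↥Λ => ((U e'.1 : SUN N) : Matrix (Fin N) (Fin N) ℂ)) :=
    continuous_pi fun e => continuous_subtype_val.comp (continuous_apply _)
  have hFcyl : IsCylinder F Λ := isCylinder_matrixCylinder Λ f
  have hFc : Continuous F := hf.continuous.comp hres
  obtain ⟨C, hC⟩ := hbdd hFc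
  have hF2cyl : IsCylinder (fun U => F U ^ 2) Λ := fun U V hUV => by show F U ^ 2 = F V ^ 2; rw [hFcyl hUV]
  have hF2c : Continuous fun U => F U ^ 2 := hFc.pow 2
  have hGcyl : ∀ e : ↥Λ, IsCylinder (Gr e) Λ := fun e U V hUV => by
    show linkGradSq Λ f e _ = linkGradSq Λ f e _
    rw [show (fun e' : ↥Λ => ((U e'.1 : SUN N) : Matrix (Fin N) (Fin N) ℂ)) = fun e' : ↥Λ => ((V e'.1 : SUN N) : Matrix (Fin N) (Fin N) ℂ) from
      funext fun e' => by rw [hUV e'.1 e'.2]]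
  have hGc : ∀ e : ↥Λ, Continuous (Gr e) := fun e => (continuous_linkGradSq Λ hf e).comp hres
  have ht1 := hlim F Λ hFcyl hFc ⟨C, hC⟩
  have ht2 := hlim (fun U => F U ^ 2) Λ hF2cyl hF2c (hbdd hF2c)
  have htG : Tendsto (fun k => ∑ e : ↥Λ, wilsonExpectation (L := Ls k + 1) (fundamentalRep (Fin N)) β' (toTorusObservable (Ls k + 1) (Gr e)))
      atTop (𝓝 S) :=
    tendsto_finsetSum _ fun e _ => hlim (Gr e) Λ (hGcyl e) (hGc e) (hbdd (hGc e))
  -- the variance of `μ` as a limit of torus variances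
  have hmem : MemLp F 2 μ := MemLp.of_bound hFc.aestronglyMeasurable C (ae_of_all _ fun U => by
    rw [Real.norm_eq_abs]; exact hC U)
  have hvarμ : Var[F; μ] = (∫ U, F U ^ 2 ∂μ) - (∫ U, F U ∂μ) ^ 2 := by rw [variance_eq_sub hmem]; rfl
  have htv : Tendsto (fun k => wilsonExpectation (L := Ls k + 1) (fundamentalRep (Fin N)) β'
        (toTorusObservable (Ls k + 1) fun U => F U ^ 2) -
      wilsonExpectation (L := Ls k + 1) (fundamentalRep (Fin N)) β' (toTorusObservable (Ls k + 1) F) ^ 2)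
      atTop (𝓝 (Var[F; μ])) := by
    rw [hvarμ]
    exact ht2.sub (ht1.pow 2)
  -- on every torus large enough, the torus gradient-form inequality (§3)
  have hev : ∀ᶠ k : ℕ in atTop,
      wilsonExpectation (L := Ls k + 1) (fundamentalRep (Fin N)) β' (toTorusObservable (Ls k + 1) fun U => F U ^ 2) -
        wilsonExpectation (L := Ls k + 1) (fundamentalRep (Fin N)) β' (toTorusObservable (Ls k + 1) F) ^ 2
        ≤ (∑ e : ↥Λ, wilsonExpectation (L := Ls k + 1) (fundamentalRep (Fin N)) β' (toTorusObservable (Ls k + 1) (Gr e))) / K := by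
    have hinj : ∀ᶠ k : ℕ in atTop, Set.InjOn (torusEdge (d := d) (Ls k + 1)) ↑Λ := by
      have h1 := eventually_injOn_torusEdge' (d := d) Λ
      have h2 : Tendsto (fun k => Ls k + 1) atTop atTop :=
        tendsto_atTop_mono (fun k => Nat.le_succ (Ls k)) hLs.tendsto_atTop
      exact h2.eventually h1
    refine hinj.mono fun k hk => ?_
    set L : ℕ := Ls k + 1 with hL'
    set μ' : Measure (GaugeConfig d L (SUN N)) := wilsonMeasure (d := d) (L := L) (fundamentalRep (Fin N)) β' with hμ'
    haveI : IsProbabilityMeasure μ' :=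
      isProbabilityMeasure_wilsonMeasure (d := d) (L := L) (fundamentalRep (Fin N)) (continuous_fundamentalRep (Fin N)) β'
    have hT := torus_cylinder_variance_gradient_sun (L := L) hH hN hK Λ hk f hf
    have hFLc : Continuous fun V : GaugeConfig d L (SUN N) => F (torusLift L V) :=
      hFc.comp (continuous_pi fun e => continuous_apply (torusEdge L e))
    have hmemk : MemLp (fun V : GaugeConfig d L (SUN N) => F (torusLift L V)) 2 μ' :=
      MemLp.of_bound hFLc.aestronglyMeasurable C (ae_of_all _ fun V => by
        rw [Real.norm_eq_abs]; exact hC (torusLift L V))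
    have hv2 : Var[fun V : GaugeConfig d L (SUN N) => F (torusLift L V); μ'] =
        wilsonExpectation (L := L) (fundamentalRep (Fin N)) β' (toTorusObservable L fun U => F U ^ 2) -
          wilsonExpectation (L := L) (fundamentalRep (Fin N)) β' (toTorusObservable L F) ^ 2 := by
      rw [variance_eq_sub hmemk]; rfl
    rw [← hv2]
    exact hT
  exact le_of_tendsto_of_tendsto htv (htG.div_const K) hev

/-- ★★★ **Sharp window, every `SU(N)`, every `d`**: for `|β| < 1/(8d)` (`K = N/2 − 4dN|β| > 0`, the venture's kernel Hessian count `Λ₀ = 4d`), every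
infinite-volume limit point `μ` and every smooth cylinder function `F`: `Var_μ(F) ≤ (Σ_{e∈Λ} μ(|∇_e F|²))/(N/2 − 4dN|β|)`.  The Yang–Mills mass gap is NOT
proved. [cite: ShenZhuZhu2022, Theorem 1.4 (1.10)] -/
theorem szz_poincare_gradient_sharp_sun (hN : N ≠ 0) {β : ℝ} (hK : 0 < (N : ℝ) / 2 - N * |β| * (4 * d))
    {μ : Measure (LGConfig d (SUN N))} (hμ : μ ∈ infiniteVolumeLimitPoints (d := d) (fundamentalRep (Fin N)) ((N : ℝ) * β))
    (Λ : Finset (Literature.MathematicalPhysics.QuantumLattice.ZdEdge d)) (f : (↥Λ → Matrix (Fin N) (Fin N) ℂ) → ℝ) (hf : ContDiff ℝ ∞ f) :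
    Var[matrixCylinder Λ f; μ] ≤
      (∑ e : ↥Λ, ∫ U, linkGradSq Λ f e (fun e' : ↥Λ => ((U e'.1 : SUN N) : Matrix (Fin N) (Fin N) ℂ)) ∂μ) / ((N : ℝ) / 2 - N * |β| * (4 * d)) :=
  szz_cylinder_variance_gradient_limit_sun (wilsonHessianBound_four_d d N) hN hK hμ Λ f hf

/-- SZZ's printed constant is dominated by the sharp one: for `d ≥ 2`, `K_S = N/2 − 8(d−1)N|β| ≤ N/2 − 4dN|β|`. [cite: ShenZhuZhu2022, Assumption 1.1] -/
theorem szzBakryEmeryConstSU_le_sharp (hd : 2 ≤ d) (N : ℕ) (β : ℝ) :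
    szzBakryEmeryConstSU N d β ≤ (N : ℝ) / 2 - N * |β| * (4 * d) := by
  rw [szzBakryEmeryConstSU_eq_transfer]
  have hd' : (2 : ℝ) ≤ d := by exact_mod_cast hd
  have h1 : (4 : ℝ) * d ≤ 8 * ((d : ℝ) - 1) := by linarith
  have h2 : 0 ≤ (N : ℝ) * |β| := by positivity
  nlinarith

/-- ★★★ **Shen–Zhu–Zhu, Theorem 1.4 (1.10) / Corollary 4.5 (4.13) AS PRINTED (Poincaré half, gradient form), every `SU(N)`, every `d ≥ 2`.**  Under
Assumption 1.1 (`|β| < 1/(16(d−1))`, `K_S = (N+2)/2 − 1 − 8N|β|(d−1) > 0`), for every infinite-volume limit point `μ` of the torus `SU(N)` Wilson states at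
tree coupling `Nβ`, every finite edge set `Λ` and every smooth cylinder function `F = f((U_e)_{e∈Λ})`: `Var_μ(F) ≤ (1/K_S) Σ_{e∈Λ} μ(|∇_e F|²)`,
`|∇_e F|² = linkGradSq Λ f e` (Parseval frame of right-invariant fields, SZZ §2).  Unconditional (venture `YMGap` Bakry–Émery inequality, sharp `K ≥ K_S`).
HONEST FRAMING: strong coupling, lattice; not a continuum or mass-gap statement. [cite: ShenZhuZhu2022, Theorem 1.4 (1.10), Corollary 4.5 (4.13)] -/
theorem szz_poincare_gradient_printed_sun (hd : 2 ≤ d) (hN : 1 ≤ N) {β : ℝ} (hβ : |β| < szzThresholdSU d)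
    {μ : Measure (LGConfig d (SUN N))} (hμ : μ ∈ infiniteVolumeLimitPoints (d := d) (fundamentalRep (Fin N)) ((N : ℝ) * β))
    (Λ : Finset (Literature.MathematicalPhysics.QuantumLattice.ZdEdge d)) (f : (↥Λ → Matrix (Fin N) (Fin N) ℂ) → ℝ) (hf : ContDiff ℝ ∞ f) :
    Var[matrixCylinder Λ f; μ] ≤
      1 / szzBakryEmeryConstSU N d β * ∑ e : ↥Λ, ∫ U, linkGradSq Λ f e (fun e' : ↥Λ => ((U e'.1 : SUN N) : Matrix (Fin N) (Fin N) ℂ)) ∂μ := by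
  have hKS : 0 < szzBakryEmeryConstSU N d β := (szzBakryEmeryConstSU_pos_iff hd hN β).2 hβ
  have hle := szzBakryEmeryConstSU_le_sharp hd N β
  have hK : 0 < (N : ℝ) / 2 - N * |β| * (4 * d) := hKS.trans_le hle
  have hN0 : N ≠ 0 := by omega
  have h := szz_poincare_gradient_sharp_sun hN0 hK hμ Λ f hf
  have hS : 0 ≤ ∑ e : ↥Λ, ∫ U, linkGradSq Λ f e (fun e' : ↥Λ => ((U e'.1 : SUN N) : Matrix (Fin N) (Fin N) ℂ)) ∂μ :=
    Finset.sum_nonneg fun e _ => integral_nonneg fun U => linkGradSq_nonneg' Λ f e _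
  rw [one_div, inv_mul_eq_div]
  exact h.trans (div_le_div_of_nonneg_left hS hKS hle)

/-- ★★ **SZZ Corollary 4.4 (4.11) AS PRINTED (Poincaré half, gradient form) on every torus, every `SU(N)`, `d ≥ 2`**: under Assumption 1.1, for every
`L`, every finite `Λ ⊆ E⁺(ℤ^d)` projecting injectively onto `(ℤ/L)^d` and every smooth `f`: `Var_{μ_{Λ_L,N,β}}(F∘lift) ≤ (1/K_S) Σ_{e∈Λ} μ_{Λ_L,N,β}(|∇_e F|²)`.
[cite: ShenZhuZhu2022, Corollary 4.4 (4.11)] -/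
theorem szz_poincare_gradient_printed_torus_sun {L : ℕ} [NeZero L] (hd : 2 ≤ d) (hN : 1 ≤ N) {β : ℝ} (hβ : |β| < szzThresholdSU d)
    (Λ : Finset (Literature.MathematicalPhysics.QuantumLattice.ZdEdge d)) (hinj : Set.InjOn (torusEdge (d := d) L) ↑Λ)
    (f : (↥Λ → Matrix (Fin N) (Fin N) ℂ) → ℝ) (hf : ContDiff ℝ ∞ f) :
    Var[fun V : GaugeConfig d L (SUN N) => matrixCylinder Λ f (torusLift L V); wilsonMeasure (d := d) (L := L) (fundamentalRep (Fin N)) ((N : ℝ) * β)] ≤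
      1 / szzBakryEmeryConstSU N d β * ∑ e : ↥Λ, ∫ V, linkGradSq Λ f e (fun e' : ↥Λ => ((torusLift L V e'.1 : SUN N) : Matrix (Fin N) (Fin N) ℂ))
          ∂(wilsonMeasure (d := d) (L := L) (fundamentalRep (Fin N)) ((N : ℝ) * β)) := by
  have hKS : 0 < szzBakryEmeryConstSU N d β := (szzBakryEmeryConstSU_pos_iff hd hN β).2 hβ
  have hle := szzBakryEmeryConstSU_le_sharp hd N β
  have hK : 0 < (N : ℝ) / 2 - N * |β| * (4 * d) := hKS.trans_le hle
  have hN0 : N ≠ 0 := by omega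
  have h := torus_cylinder_variance_gradient_sharp_sun (L := L) hN0 hK Λ hinj f hf
  have hS : 0 ≤ ∑ e : ↥Λ, ∫ V, linkGradSq Λ f e (fun e' : ↥Λ => ((torusLift L V e'.1 : SUN N) : Matrix (Fin N) (Fin N) ℂ))
      ∂(wilsonMeasure (d := d) (L := L) (fundamentalRep (Fin N)) ((N : ℝ) * β)) :=
    Finset.sum_nonneg fun e _ => integral_nonneg fun U => linkGradSq_nonneg' Λ f e _
  rw [one_div, inv_mul_eq_div]
  exact h.trans (div_le_div_of_nonneg_left hS hKS hle)

end Limits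

end Summit.QuantumFields.YangMills.Theorems.ColdStartUniversality

end
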